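import Mathlib
import HarnessLib
import Literature.Computability.AlgebraicComplexity.PatternExpressions
import Summits.ValiantsHypothesis.ValiantsHypothesis.Theorems.MonotoneRestorationMonotoneRestorationQPHomExpansionUnique

/-!
# Matrix-symmetric polynomials are spanned by homomorphism polynomials — tools

Route MonotoneRestoration; crux `OrbitRestorationQP` (stmt-18293: K1 `NarrowExpansionVP` / K1ᵉ say that
matrix-symmetric `VP` families lie in the span of homomorphism polynomials of patterns of POLYLOG treewidth)
and the derived node `NonnegRestorationQP` (stmt-16191, whose `stub_orbitCompression` = `OrbitCompressionQP`
is cut through narrow pattern expressions).  Dwivedi–Pago–Seppelt 2026 Lemma 8.18 (tree: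
`HomExpansionUnique.homPoly_linearIndependent`) is the INDEPENDENCE half of "homomorphism polynomials of
bipartite patterns form a basis of the `Sym_n × Sym_n`-invariant polynomials on the `n × n` matrix"; the
SPANNING half (every matrix-symmetric polynomial is a `ℂ`-combination of homomorphism polynomials of
patterns with at most `deg`-many vertices a side — DPS26 §8 via injective homomorphism polynomials and
Möbius inversion) is not in the tree.  This file supplies the tools for it (sequel: `…HomSpan.lean`):

* `orbitSum_mapDomain` — the `Sym_n × Sym_n`-orbit sum `Σ_g x^{g·D}` of a monomial exponent `D` is constant
  on orbits;
* `card_smul_eq_sum_orbitSum` — Reynolds: `|G| · p = Σ_{D ∈ supp p} coeff_D(p) · orbitSum D` for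
  matrix-symmetric `p`;
* `homPoly_eq_sum_monomial`, `card_smul_homPoly_eq_sum_orbitSum` — `hom_{F,n} = Σ_h x^{D_h}` over vertex
  maps `h`, `D_h` the pushed-forward edge multiset, and `|G| · hom_{F,n} = Σ_h orbitSum D_h`;
* `exists_perm_comp_eq` — two injective maps `A → Fin n` differ by a permutation of `Fin n`;
  `orbitSum_push_eq_of_injective` — so injective placements of one pattern have the same orbit sum;
* `toFinsupp_map`, `support_push_image_fst/snd` — bookkeeping of pushed-forward exponents (the rows used by
  `D_h` are the image of `h.1` when the pattern has no isolated row vertex).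

Everything is def-free (orbit sums and pushes are written out) and proved. [cite: DwivediPagoSeppelt2026, §8 (Lemma 8.18)]
-/

noncomputable section

open MvPolynomial

-- `Summit.ValiantsHypothesis.ValiantsHypothesis.…` is the tree's single-conjunct layout (Sub = Summit).
set_option linter.dupNamespace false

namespace Summit.ValiantsHypothesis.ValiantsHypothesis.Theorems

namespace HomSpan

open Literature.Computability.AlgebraicComplexity

variable {n : ℕ}

/-! ### Orbit sums of monomial exponents -/

/-- Composition of the cell actions of two pairs of permutations. [folklore] -/
theorem mapDomain_mapDomain_act (D : (Fin n × Fin n) →₀ ℕ)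
    (g g' : Equiv.Perm (Fin n) × Equiv.Perm (Fin n)) :
    (D.mapDomain fun ij : Fin n × Fin n => (g.1 ij.1, g.2 ij.2)).mapDomain
        (fun ij : Fin n × Fin n => (g'.1 ij.1, g'.2 ij.2)) =
      D.mapDomain fun ij : Fin n × Fin n => ((g' * g).1 ij.1, (g' * g).2 ij.2) := by
  rw [← Finsupp.mapDomain_comp]
  rfl

/-- **The orbit sum `Σ_{g ∈ Sym_n × Sym_n} x^{g·D}` is constant on orbits.** [folklore] -/
theorem orbitSum_mapDomain (D : (Fin n × Fin n) →₀ ℕ) (g : Equiv.Perm (Fin n) × Equiv.Perm (Fin n)) :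
    (∑ g' : Equiv.Perm (Fin n) × Equiv.Perm (Fin n),
        monomial ((D.mapDomain fun ij : Fin n × Fin n => (g.1 ij.1, g.2 ij.2)).mapDomain
          fun ij : Fin n × Fin n => (g'.1 ij.1, g'.2 ij.2)) (1 : ℂ)) =
      ∑ g' : Equiv.Perm (Fin n) × Equiv.Perm (Fin n),
        monomial (D.mapDomain fun ij : Fin n × Fin n => (g'.1 ij.1, g'.2 ij.2)) (1 : ℂ) := by
  simp_rw [mapDomain_mapDomain_act]
  exact Fintype.sum_equiv (Equiv.mulRight g) _ _ fun g' => rfl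

/-- **Reynolds identity for a matrix-symmetric polynomial**: `|G| · p = Σ_{D ∈ supp p} coeff_D(p) · orbitSum D`.
[folklore] -/
theorem card_smul_eq_sum_orbitSum (p : MvPolynomial (Fin n × Fin n) ℂ)
    (hp : ∀ σ τ : Equiv.Perm (Fin n),
      rename (fun ij : Fin n × Fin n => (σ ij.1, τ ij.2)) p = p) :
    (Fintype.card (Equiv.Perm (Fin n) × Equiv.Perm (Fin n)) : ℂ) • p =
      ∑ D ∈ p.support, p.coeff D • ∑ g : Equiv.Perm (Fin n) × Equiv.Perm (Fin n),
        monomial (D.mapDomain fun ij : Fin n × Fin n => (g.1 ij.1, g.2 ij.2)) (1 : ℂ) := by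
  have h1 : (Fintype.card (Equiv.Perm (Fin n) × Equiv.Perm (Fin n)) : ℂ) • p =
      ∑ g : Equiv.Perm (Fin n) × Equiv.Perm (Fin n),
        rename (fun ij : Fin n × Fin n => (g.1 ij.1, g.2 ij.2)) p := by
    rw [Finset.sum_congr rfl fun g _ => hp g.1 g.2, Finset.sum_const, Finset.card_univ,
      ← Nat.cast_smul_eq_nsmul ℂ]
  rw [h1]
  have h2 : ∀ g : Equiv.Perm (Fin n) × Equiv.Perm (Fin n),
      rename (fun ij : Fin n × Fin n => (g.1 ij.1, g.2 ij.2)) p =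
        ∑ D ∈ p.support, p.coeff D •
          monomial (D.mapDomain fun ij : Fin n × Fin n => (g.1 ij.1, g.2 ij.2)) (1 : ℂ) := by
    intro g
    conv_lhs => rw [p.as_sum]
    rw [map_sum]
    refine Finset.sum_congr rfl fun D _ => ?_
    rw [rename_monomial, smul_monomial, smul_eq_mul, mul_one]
  simp_rw [h2]
  rw [Finset.sum_comm]
  refine Finset.sum_congr rfl fun D _ => ?_
  rw [Finset.smul_sum]

/-! ### Homomorphism polynomials as sums of monomials, and their Reynolds identity -/

/-- Pushing forward a multiset and converting to a finitely supported function commute. [folklore] -/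
theorem toFinsupp_map {α β : Type*} [DecidableEq α] [DecidableEq β] (M : Multiset α) (f : α → β) :
    Multiset.toFinsupp (M.map f) = (Multiset.toFinsupp M).mapDomain f := by
  induction M using Multiset.induction with
  | empty => simp
  | cons a M ih =>
    rw [← Multiset.singleton_add, Multiset.map_add, Multiset.map_singleton, map_add, map_add,
      Multiset.toFinsupp_singleton, Multiset.toFinsupp_singleton, Finsupp.mapDomain_add,
      Finsupp.mapDomain_single, ih]

/-- **`hom_{F,n}` is the sum over vertex maps `h` of the monomials `x^{D_h}`**, `D_h` the pushed-forward
edge multiset. [cite: DwivediPagoSeppelt2026, eq. (1)] -/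
theorem homPoly_eq_sum_monomial {A B : Type} [Fintype A] [DecidableEq A] [Fintype B] [DecidableEq B]
    (E : Multiset (A × B)) (n : ℕ) :
    homPoly E n ℂ = ∑ h : (A → Fin n) × (B → Fin n),
      monomial (Multiset.toFinsupp (E.map fun e => (h.1 e.1, h.2 e.2))) (1 : ℂ) := by
  unfold homPoly
  exact Finset.sum_congr rfl fun h _ => HomExpansionUnique.prod_map_X_eq_monomial _ _

/-- **Reynolds identity for a homomorphism polynomial**: `|G| · hom_{F,n} = Σ_h orbitSum D_h`. [folklore] -/
theorem card_smul_homPoly_eq_sum_orbitSum {A B : Type} [Fintype A] [DecidableEq A] [Fintype B]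
    [DecidableEq B] (E : Multiset (A × B)) (n : ℕ) :
    (Fintype.card (Equiv.Perm (Fin n) × Equiv.Perm (Fin n)) : ℂ) • homPoly E n ℂ =
      ∑ h : (A → Fin n) × (B → Fin n), ∑ g : Equiv.Perm (Fin n) × Equiv.Perm (Fin n),
        monomial ((Multiset.toFinsupp (E.map fun e => (h.1 e.1, h.2 e.2))).mapDomain
          fun ij : Fin n × Fin n => (g.1 ij.1, g.2 ij.2)) (1 : ℂ) := by
  rw [card_smul_eq_sum_orbitSum _ (fun σ τ => rename_perm_homPoly E n ℂ σ τ)]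
  -- expand `hom` in monomials on the left and collect orbit sums
  have hco : ∀ D : (Fin n × Fin n) →₀ ℕ, (homPoly E n ℂ).coeff D =
      ((Finset.univ.filter fun h : (A → Fin n) × (B → Fin n) =>
          Multiset.toFinsupp (E.map fun e => (h.1 e.1, h.2 e.2)) = D).card : ℂ) :=
    fun D => HomExpansionUnique.coeff_homPoly E n D
  symm
  calc ∑ h : (A → Fin n) × (B → Fin n), ∑ g : Equiv.Perm (Fin n) × Equiv.Perm (Fin n),
        monomial ((Multiset.toFinsupp (E.map fun e => (h.1 e.1, h.2 e.2))).mapDomain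
          fun ij : Fin n × Fin n => (g.1 ij.1, g.2 ij.2)) (1 : ℂ)
      = ∑ h : (A → Fin n) × (B → Fin n), ∑ D ∈ (homPoly E n ℂ).support,
          (if Multiset.toFinsupp (E.map fun e => (h.1 e.1, h.2 e.2)) = D then
            ∑ g : Equiv.Perm (Fin n) × Equiv.Perm (Fin n),
              monomial (D.mapDomain fun ij : Fin n × Fin n => (g.1 ij.1, g.2 ij.2)) (1 : ℂ) else 0) := by
        refine Finset.sum_congr rfl fun h _ => ?_
        rw [Finset.sum_ite_eq]
        rw [if_pos]
        rw [mem_support_iff, hco]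
        norm_cast
        refine Finset.card_ne_zero.2 ⟨h, ?_⟩
        simp
    _ = ∑ D ∈ (homPoly E n ℂ).support, ∑ h : (A → Fin n) × (B → Fin n),
          (if Multiset.toFinsupp (E.map fun e => (h.1 e.1, h.2 e.2)) = D then
            ∑ g : Equiv.Perm (Fin n) × Equiv.Perm (Fin n),
              monomial (D.mapDomain fun ij : Fin n × Fin n => (g.1 ij.1, g.2 ij.2)) (1 : ℂ) else 0) :=
        Finset.sum_comm
    _ = ∑ D ∈ (homPoly E n ℂ).support, (homPoly E n ℂ).coeff D •
          ∑ g : Equiv.Perm (Fin n) × Equiv.Perm (Fin n),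
            monomial (D.mapDomain fun ij : Fin n × Fin n => (g.1 ij.1, g.2 ij.2)) (1 : ℂ) := by
        refine Finset.sum_congr rfl fun D _ => ?_
        rw [Finset.sum_ite, Finset.sum_const_zero, add_zero, Finset.sum_const, hco, Nat.cast_smul_eq_nsmul]

/-! ### Injective placements -/

/-- **Two injective maps into `Fin n` differ by a permutation of `Fin n`.** [folklore] -/
theorem exists_perm_comp_eq {A : Type*} (h h' : A → Fin n) (hh : Function.Injective h)
    (hh' : Function.Injective h') : ∃ σ : Equiv.Perm (Fin n), ∀ a, σ (h a) = h' a := by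
  classical
  let e : {x // x ∈ Set.range h} ≃ {x // x ∈ Set.range h'} :=
    (Equiv.ofInjective h hh).symm.trans (Equiv.ofInjective h' hh')
  refine ⟨e.extendSubtype, fun a => ?_⟩
  rw [Equiv.extendSubtype_apply_of_mem e (h a) ⟨a, rfl⟩]
  simp [e, Equiv.ofInjective_symm_apply]

/-- **Injective placements of one pattern have the same orbit sum.** [folklore] -/
theorem orbitSum_push_eq_of_injective {A B : Type} [Fintype A] [DecidableEq A] [Fintype B]
    [DecidableEq B] (E : Multiset (A × B)) (h h' : (A → Fin n) × (B → Fin n))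
    (h1 : Function.Injective h.1) (h2 : Function.Injective h.2)
    (h1' : Function.Injective h'.1) (h2' : Function.Injective h'.2) :
    (∑ g : Equiv.Perm (Fin n) × Equiv.Perm (Fin n),
        monomial ((Multiset.toFinsupp (E.map fun e => (h'.1 e.1, h'.2 e.2))).mapDomain
          fun ij : Fin n × Fin n => (g.1 ij.1, g.2 ij.2)) (1 : ℂ)) =
      ∑ g : Equiv.Perm (Fin n) × Equiv.Perm (Fin n),
        monomial ((Multiset.toFinsupp (E.map fun e => (h.1 e.1, h.2 e.2))).mapDomain
          fun ij : Fin n × Fin n => (g.1 ij.1, g.2 ij.2)) (1 : ℂ) := by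
  classical
  obtain ⟨σ, hσ⟩ := exists_perm_comp_eq h.1 h'.1 h1 h1'
  obtain ⟨τ, hτ⟩ := exists_perm_comp_eq h.2 h'.2 h2 h2'
  have key : Multiset.toFinsupp (E.map fun e => (h'.1 e.1, h'.2 e.2)) =
      (Multiset.toFinsupp (E.map fun e => (h.1 e.1, h.2 e.2))).mapDomain
        fun ij : Fin n × Fin n => (σ ij.1, τ ij.2) := by
    rw [← toFinsupp_map, Multiset.map_map]
    congr 1
    refine Multiset.map_congr rfl fun e _ => ?_
    simp [hσ, hτ]
  have hos := orbitSum_mapDomain (Multiset.toFinsupp (E.map fun e => (h.1 e.1, h.2 e.2))) (σ, τ)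
  dsimp only at hos
  rw [key]
  exact hos

/-! ### Rows and columns used by a pushed-forward exponent -/

/-- The rows used by `D_h` are the images under `h.1` of the non-isolated row vertices; for a pattern
WITHOUT isolated row vertices they are the image of `h.1`. [folklore] -/
theorem support_push_image_fst {A B : Type} [Fintype A] [DecidableEq A] [Fintype B] [DecidableEq B]
    (E : Multiset (A × B)) (hA : ∀ a, ∃ e ∈ E, e.1 = a) (h : (A → Fin n) × (B → Fin n)) :
    (Multiset.toFinsupp (E.map fun e => (h.1 e.1, h.2 e.2))).support.image Prod.fst =
      Finset.univ.image h.1 := by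
  classical
  ext i
  simp only [Finset.mem_image, Multiset.toFinsupp_support, Multiset.mem_toFinset, Multiset.mem_map,
    Finset.mem_univ, true_and]
  constructor
  · rintro ⟨ij, ⟨e, -, rfl⟩, rfl⟩
    exact ⟨e.1, rfl⟩
  · rintro ⟨a, rfl⟩
    obtain ⟨e, he, hea⟩ := hA a
    exact ⟨(h.1 e.1, h.2 e.2), ⟨e, he, rfl⟩, by rw [hea]⟩

/-- The columns used by `D_h`, for a pattern without isolated column vertices, are the image of `h.2`.
[folklore] -/
theorem support_push_image_snd {A B : Type} [Fintype A] [DecidableEq A] [Fintype B] [DecidableEq B]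
    (E : Multiset (A × B)) (hB : ∀ b, ∃ e ∈ E, e.2 = b) (h : (A → Fin n) × (B → Fin n)) :
    (Multiset.toFinsupp (E.map fun e => (h.1 e.1, h.2 e.2))).support.image Prod.snd =
      Finset.univ.image h.2 := by
  classical
  ext j
  simp only [Finset.mem_image, Multiset.toFinsupp_support, Multiset.mem_toFinset, Multiset.mem_map,
    Finset.mem_univ, true_and]
  constructor
  · rintro ⟨ij, ⟨e, -, rfl⟩, rfl⟩
    exact ⟨e.2, rfl⟩
  · rintro ⟨b, rfl⟩
    obtain ⟨e, he, heb⟩ := hB b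
    exact ⟨(h.1 e.1, h.2 e.2), ⟨e, he, rfl⟩, by rw [heb]⟩

/-- The degree (number of edges) of a pushed-forward exponent. [folklore] -/
theorem card_toMultiset_push {A B : Type} [Fintype A] [DecidableEq A] [Fintype B] [DecidableEq B]
    (E : Multiset (A × B)) (h : (A → Fin n) × (B → Fin n)) :
    Multiset.card (Finsupp.toMultiset (Multiset.toFinsupp (E.map fun e => (h.1 e.1, h.2 e.2)))) =
      Multiset.card E := by
  rw [Multiset.toFinsupp_toMultiset, Multiset.card_map]

end HomSpan

end Summit.ValiantsHypothesis.ValiantsHypothesis.Theorems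

end
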